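import Mathlib.Topology.Algebra.ClopenNhdofOne
import Literature.AnabelianGeometry.AbsoluteAnabelian.TopFGOpenSubgroups
import Literature.AnabelianGeometry.AbsoluteAnabelian.AbsTopI.CoFreeCompletionFunctorial
import Literature.AnabelianGeometry.SemiGraphs.TemperedCompletionOpenSubgroups
import Literature.AnabelianGeometry.SemiGraphs.TemperedCompletionExistence
import HarnessLib

/-!
# [AbsTopI] §0 p. 9: a topologically finitely generated group has a basis of characteristic open
# subgroups (proof-only; the cofinality input of the `(Q, Δ)`-co-free completion of §0 p. 8)

S. Mochizuki, *Topics in Absolute Anabelian Geometry I: Generalities* [AbsTopI] (J. Math. Sci.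
Univ. Tokyo 19 (2012)), §0 "Topological Groups", manuscript p. 9 (lit key
`paper:url-11ac98ba15fc`, read on the page): "If, moreover, `G` is topologically finitely
generated, then it follows immediately that the topology of `G` admits a basis of characteristic
open subgroups".  The "immediate" argument, made explicit and PROVED here over Mathlib: a
topologically finitely generated topological group has only finitely many open subgroups of each
finite index (abc-iut-L5-t6's `IsTopologicallyFinitelyGenerated.finite_setOf_isOpen_index`,
`TopFGOpenSubgroups.lean`), so the intersection of ALL open subgroups of the index of a given open
finite-index `V` is an open normal subgroup of finite index, contained in `V`, and carried onto
itself by every automorphism of the topological group (automorphisms permute that finite family):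

* `IsTopologicallyFinitelyGenerated.exists_charOpen_normal_le` — every open subgroup of finite
  index contains a CHARACTERISTIC (for all `G ≃ₜ* G`) open normal subgroup of finite index;
* `IsTopologicallyFinitelyGenerated.exists_charOpen_normal_subset` — for profinite `G` these form a
  neighbourhood basis of `1` (the printed sentence);
* `IsProfiniteCompletion.exists_continuousMulEquiv_extending` / `exists_charOpen_le` — transfer to
  a group `F` GIVEN WITH a profinite completion `ι : F → F̂` ([SemiAnbd] §6 p. 69 interface
  `IsProfiniteCompletion`, abc-iut-L3): every automorphism of the topological group `F` extends to
  one of `F̂` (universal property, L3's `exists_extension` / `nonempty_continuousMulEquiv`), so the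
  preimages of characteristic open subgroups of a topologically finitely generated `F̂` are
  characteristic open subgroups of finite index of `F`, cofinal among its open finite-index subgroups
  — the case of a TEMPERED group `Π^tp`, `Δ^tp` with its profinite completion (Prop 4.10 p. 60);
* `AbsTopI.CharOpenSubgroup.exists_le` / `exists_le_of_completion` — packaged for the index set of
  the `(Q, Δ)`-co-free completion ([AbsTopI] §0 p. 8, `AbsTopI/CofreeCore.lean`, abc-iut-L4-t13): if `Δ` (subspace
  topology) is topologically finitely generated, the characteristic open subgroups of finite index
  of `Δ` are COFINAL among the open subgroups of finite index of `Δ` — so the inverse limit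
  `lim_H Im_Q(Π/H^{co-fr})` runs over a cofinal system.

HONEST FRAMING: general topology/group theory from a refereed paper's §0; nothing here bears on
[IUTchIII] Cor 3.12.
-/

universe u v

namespace Literature.AnabelianGeometry.AbsoluteAnabelian.IsTopologicallyFinitelyGenerated

variable {G : Type u} [Group G] [TopologicalSpace G] [IsTopologicalGroup G]

omit [IsTopologicalGroup G] in
/-- An automorphism of the topological group carries an open subgroup of index `n` to an open
subgroup of index `n`. [cite: MochizukiAbsTopI2012, §0 p.9] -/
theorem isOpen_map_and_index_eq (α : G ≃ₜ* G) {U : Subgroup G} (hU : IsOpen (U : Set G)) :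
    IsOpen ((U.map α.toMulEquiv.toMonoidHom : Subgroup G) : Set G) ∧
      (U.map α.toMulEquiv.toMonoidHom).index = U.index := by
  refine ⟨?_, Subgroup.index_map_of_bijective (f := α.toMulEquiv.toMonoidHom) α.bijective U⟩
  rw [Subgroup.coe_map]
  exact α.toHomeomorph.isOpenMap _ hU

/-- **[AbsTopI] §0 p. 9, the "immediate" step made explicit**: in a topologically finitely
generated topological group every open subgroup `V` of finite index contains an open NORMAL subgroup
`W` of finite index which is CHARACTERISTIC — `α(W) = W` for every automorphism `α` of the
topological group — namely the intersection of the finitely many open subgroups of index `[G : V]`.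
[cite: MochizukiAbsTopI2012, §0 p.9] -/
theorem exists_charOpen_normal_le (hG : IsTopologicallyFinitelyGenerated G) (V : Subgroup G)
    (hVo : IsOpen (V : Set G)) [hVi : V.FiniteIndex] :
    ∃ W : Subgroup G, W.Normal ∧ IsOpen (W : Set G) ∧ W.FiniteIndex ∧
      (∀ α : G ≃ₜ* G, W.map α.toMulEquiv.toMonoidHom = W) ∧ W ≤ V := by
  classical
  have hn0 : V.index ≠ 0 := hVi.index_ne_zero
  let S : Set (Subgroup G) := {U | IsOpen (U : Set G) ∧ U.index = V.index}
  have hS : S.Finite := finite_setOf_isOpen_index hG hn0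
  haveI : Finite S := hS.to_subtype
  letI : Fintype S := Fintype.ofFinite S
  let W : Subgroup G := ⨅ U : S, (U : Subgroup G)
  have hVS : V ∈ S := ⟨hVo, rfl⟩
  have hWle : ∀ U ∈ S, W ≤ U := fun U hU => iInf_le (fun U : S => (U : Subgroup G)) ⟨U, hU⟩
  -- `S` is permuted by automorphisms of the topological group
  have hmapS : ∀ (α : G ≃ₜ* G) {U : Subgroup G}, U ∈ S → U.map α.toMulEquiv.toMonoidHom ∈ S := by
    intro α U hU
    obtain ⟨ho, hi⟩ := isOpen_map_and_index_eq α hU.1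
    exact ⟨ho, hi.trans hU.2⟩
  -- hence `α(W) ≤ W` for every `α`
  have hmaple : ∀ α : G ≃ₜ* G, W.map α.toMulEquiv.toMonoidHom ≤ W := by
    intro α
    refine le_iInf fun U => ?_
    rw [Subgroup.map_le_iff_le_comap]
    have hU' : (U : Subgroup G).map α.symm.toMulEquiv.toMonoidHom ∈ S := hmapS α.symm U.2
    have hle : W ≤ (U : Subgroup G).map α.symm.toMulEquiv.toMonoidHom := hWle _ hU'
    intro x hx
    rw [Subgroup.mem_comap]
    obtain ⟨u, hu, hux⟩ := hle hx
    rw [← hux]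
    change α (α.symm u) ∈ (U : Subgroup G)
    rw [α.apply_symm_apply]
    exact hu
  have hchar : ∀ α : G ≃ₜ* G, W.map α.toMulEquiv.toMonoidHom = W := by
    intro α
    refine le_antisymm (hmaple α) ?_
    have h := Subgroup.map_mono (f := α.toMulEquiv.toMonoidHom) (hmaple α.symm)
    rw [Subgroup.map_map] at h
    have hc : α.toMulEquiv.toMonoidHom.comp α.symm.toMulEquiv.toMonoidHom = MonoidHom.id G :=
      MonoidHom.ext fun x => α.apply_symm_apply x
    rwa [hc, Subgroup.map_id] at h
  refine ⟨W, ?_, ?_, ?_, hchar, hWle V hVS⟩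
  · -- normal: conjugation is an automorphism of the topological group
    constructor
    intro x hx g
    have hmem : AbsTopI.conjEquiv g x ∈ W.map (AbsTopI.conjEquiv g).toMulEquiv.toMonoidHom :=
      ⟨x, hx, rfl⟩
    rw [hchar] at hmem
    exact hmem
  · -- open: a finite intersection of open subgroups
    have hcoe : (W : Set G) = ⋂ U : S, ((U : Subgroup G) : Set G) := by
      simp [W, Subgroup.coe_iInf]
    rw [hcoe]
    exact isOpen_iInter_of_finite fun U => U.2.1
  · -- finite index: a finite intersection of finite-index subgroups
    refine ⟨Subgroup.index_iInf_ne_zero fun U => ?_⟩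
    rw [U.2.2]
    exact hn0

/-- **[AbsTopI] §0 p. 9**: "if, moreover, `G` is topologically finitely generated, then [...] the
topology of `G` admits a basis of characteristic open subgroups" — for PROFINITE `G` (compact,
totally disconnected), every neighbourhood of `1` contains a characteristic open normal subgroup of
finite index. [cite: MochizukiAbsTopI2012, §0 p.9] -/
theorem exists_charOpen_normal_subset [CompactSpace G] [TotallyDisconnectedSpace G]
    (hG : IsTopologicallyFinitelyGenerated G) {s : Set G} (hs : IsOpen s) (h1 : (1 : G) ∈ s) :
    ∃ W : Subgroup G, W.Normal ∧ IsOpen (W : Set G) ∧ W.FiniteIndex ∧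
      (∀ α : G ≃ₜ* G, W.map α.toMulEquiv.toMonoidHom = W) ∧ (W : Set G) ⊆ s := by
  obtain ⟨N, hN⟩ := ProfiniteGrp.exist_openNormalSubgroup_sub_open_nhds_of_one hs h1
  have hNo : IsOpen ((N : Subgroup G) : Set G) := N.toOpenSubgroup.isOpen
  haveI : DiscreteTopology (G ⧸ (N : Subgroup G)) := QuotientGroup.discreteTopology_iff.mpr hNo
  haveI : Finite (G ⧸ (N : Subgroup G)) := finite_of_compact_of_discrete
  haveI : (N : Subgroup G).FiniteIndex := Subgroup.finiteIndex_of_finite_quotient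
  obtain ⟨W, hWn, hWo, hWi, hWc, hWle⟩ := exists_charOpen_normal_le hG (N : Subgroup G) hNo
  exact ⟨W, hWn, hWo, hWi, hWc, fun x hx => hN (hWle hx)⟩

end Literature.AnabelianGeometry.AbsoluteAnabelian.IsTopologicallyFinitelyGenerated

/-! ### Transfer along a profinite completion `ι : F → F̂` -/

namespace Literature.AnabelianGeometry.SemiGraphs.IsProfiniteCompletion

open Literature.AnabelianGeometry.AbsoluteAnabelian

variable {F : Type u} {Fhat : Type v} [Group F] [TopologicalSpace F] [IsTopologicalGroup F]
  [Group Fhat] [TopologicalSpace Fhat] [IsTopologicalGroup Fhat] {ι : F →ₜ* Fhat}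

omit [IsTopologicalGroup F] [IsTopologicalGroup Fhat] in
/-- Precomposing a profinite completion with an automorphism of the topological group gives a
profinite completion. [cite: MochizukiSemiAnbd2006, §6 p.69] -/
theorem comp_continuousMulEquiv (hι : IsProfiniteCompletion ι) (α : F ≃ₜ* F) :
    IsProfiniteCompletion (ι.comp (α : F →ₜ* F)) := by
  refine ⟨hι.compactSpace, hι.t2Space, hι.totallyDisconnectedSpace, ?_, ?_, ?_⟩
  · -- dense range: `α` is surjective
    have happ : ∀ x : F, (ι.comp (α : F →ₜ* F)) x = ι (α x) := fun x => rfl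
    have hr : Set.range (ι.comp (α : F →ₜ* F)) = Set.range ι := by
      ext z
      constructor
      · rintro ⟨x, rfl⟩
        exact ⟨α x, (happ x).symm⟩
      · rintro ⟨x, rfl⟩
        exact ⟨α.symm x, by rw [happ, α.apply_symm_apply]⟩
    change Dense (Set.range _)
    rw [hr]
    exact hι.denseRange
  · -- open normal finite-index subgroups of `F` are preimages: transport through `α`
    intro U hU
    -- `α(U)` is open normal of finite index
    haveI : (U.toSubgroup.map α.toMulEquiv.toMonoidHom).Normal :=
      Subgroup.Normal.map inferInstance _ α.surjective
    let U' : OpenNormalSubgroup F :=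
      { toSubgroup := U.toSubgroup.map α.toMulEquiv.toMonoidHom
        isOpen' := by
          change IsOpen ((U.toSubgroup.map α.toMulEquiv.toMonoidHom : Subgroup F) : Set F)
          rw [Subgroup.coe_map]
          exact α.toHomeomorph.isOpenMap _ U.isOpen }
    have hU' : U'.toSubgroup.FiniteIndex := by
      change (U.toSubgroup.map α.toMulEquiv.toMonoidHom).FiniteIndex
      constructor
      rw [Subgroup.index_map_of_bijective (f := α.toMulEquiv.toMonoidHom) α.bijective]
      exact hU.index_ne_zero
    obtain ⟨V, hV⟩ := hι.comap_surjective U' hU'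
    refine ⟨V, ?_⟩
    ext x
    constructor
    · intro h
      have hx : α x ∈ U'.toSubgroup := ⟨x, h, rfl⟩
      rw [hV] at hx
      exact hx
    · intro h
      have hx : α x ∈ U'.toSubgroup := by
        rw [hV]
        exact h
      obtain ⟨y, hy, hyx⟩ := hx
      rwa [← α.injective hyx]
  · intro V
    have h := hι.isOpen_comap V
    have hc : ((V.toSubgroup.comap (ι.comp (α : F →ₜ* F)).toMonoidHom : Subgroup F) : Set F) =
        α ⁻¹' (V.toSubgroup.comap ι.toMonoidHom : Set F) := rfl
    rw [hc]
    exact h.preimage α.continuous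

omit [IsTopologicalGroup F] in
/-- **Automorphisms extend to the profinite completion**: for `ι : F → F̂` a profinite completion and
`α` an automorphism of the topological group `F`, there is an automorphism `α̂` of `F̂` with
`α̂ ∘ ι = ι ∘ α` (universal property, [SemiAnbd] §6 p. 69 "THE profinite completion").
[cite: MochizukiSemiAnbd2006, §6 p.69] -/
theorem exists_continuousMulEquiv_extending (hι : IsProfiniteCompletion ι) (α : F ≃ₜ* F) :
    ∃ e : Fhat ≃ₜ* Fhat, ∀ x : F, e (ι x) = ι (α x) := by
  obtain ⟨e, he⟩ := nonempty_continuousMulEquiv hι (hι.comp_continuousMulEquiv α)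
  exact ⟨e, fun x => he x⟩

/-- **Characteristic open subgroups of `F` from those of `F̂`**: if `ι : F → F̂` is a profinite
completion with `F̂` topologically finitely generated, every open subgroup `V` of finite index of `F`
contains an open subgroup `W` of finite index which is characteristic for all automorphisms of the
TOPOLOGICAL group `F` — namely `W := ι⁻¹(Ŵ)` for a characteristic open `Ŵ ⊆ closure ι(V)`
([AbsTopI] §0 p. 9 applied to `F̂`, transported by `exists_continuousMulEquiv_extending`).
[cite: MochizukiAbsTopI2012, §0 p.9] -/
theorem exists_charOpen_le (hι : IsProfiniteCompletion ι)
    (hfg : AbsoluteAnabelian.IsTopologicallyFinitelyGenerated Fhat) (V : Subgroup F)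
    (hVo : IsOpen (V : Set F)) [V.FiniteIndex] :
    ∃ W : Subgroup F, IsOpen (W : Set F) ∧ W.FiniteIndex ∧
      (∀ α : F ≃ₜ* F, W.map α.toMulEquiv.toMonoidHom = W) ∧ W ≤ V := by
  haveI := hι.compactSpace
  -- the closure of `ι(V)` is open of finite index in `F̂`, with preimage `V`
  have hVho : IsOpen (((V.map ι.toMonoidHom).topologicalClosure : Subgroup Fhat) : Set Fhat) :=
    hι.isOpen_topologicalClosure_map V hVo
  haveI : ((V.map ι.toMonoidHom).topologicalClosure).FiniteIndex := by
    haveI : DiscreteTopology (Fhat ⧸ (V.map ι.toMonoidHom).topologicalClosure) :=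
      QuotientGroup.discreteTopology_iff.mpr hVho
    haveI : Finite (Fhat ⧸ (V.map ι.toMonoidHom).topologicalClosure) := finite_of_compact_of_discrete
    exact Subgroup.finiteIndex_of_finite_quotient
  obtain ⟨What, _, hWo, hWi, hWc, hWle⟩ :=
    hfg.exists_charOpen_normal_le ((V.map ι.toMonoidHom).topologicalClosure) hVho
  refine ⟨What.comap ι.toMonoidHom, ?_, ?_, ?_, ?_⟩
  · rw [Subgroup.coe_comap]
    exact hWo.preimage ι.continuous
  · constructor
    rw [Subgroup.index_comap]
    exact Subgroup.FiniteIndex.index_ne_zero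
  · intro α
    obtain ⟨e, he⟩ := exists_continuousMulEquiv_extending hι α
    apply le_antisymm
    · rintro _ ⟨x, hx, rfl⟩
      change ι x ∈ What at hx
      change ι (α x) ∈ What
      rw [← he x]
      have hmem : e (ι x) ∈ What.map e.toMulEquiv.toMonoidHom := ⟨ι x, hx, rfl⟩
      rwa [hWc e] at hmem
    · intro x hx
      change ι x ∈ What at hx
      refine ⟨α.symm x, ?_, α.apply_symm_apply x⟩
      change ι (α.symm x) ∈ What
      have hx' : e (ι (α.symm x)) ∈ What := by
        rw [he, α.apply_symm_apply]
        exact hx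
      have hmem : ι (α.symm x) ∈ What.map e.symm.toMulEquiv.toMonoidHom :=
        ⟨e (ι (α.symm x)), hx', e.symm_apply_apply _⟩
      rwa [hWc e.symm] at hmem
  · calc What.comap ι.toMonoidHom
        ≤ ((V.map ι.toMonoidHom).topologicalClosure).comap ι.toMonoidHom := Subgroup.comap_mono hWle
      _ = V := hι.comap_topologicalClosure_map V hVo

end Literature.AnabelianGeometry.SemiGraphs.IsProfiniteCompletion

/-! ### Cofinality of the index set of the `(Q, Δ)`-co-free completion -/

namespace Literature.AnabelianGeometry.AbsoluteAnabelian.AbsTopI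

variable {P : Type u} [Group P] [TopologicalSpace P] [IsTopologicalGroup P]

/-- **The index set of [AbsTopI] §0 p. 8 is cofinal**: if `Δ ≤ Π` (subspace topology) is
topologically finitely generated, every subgroup `V` whose trace `V ∩ Δ` is open and of finite
index in `Δ` contains a characteristic open subgroup of finite index of `Δ` (an element of `CharOpenSubgroup Δ`,
the index type of `CoFreeCompletion`).  Hence `lim_H Im_Q(Π/H^{co-fr})` is a limit over a cofinal
system of open finite-index subgroups of `Δ`. [cite: MochizukiAbsTopI2012, §0 p.9] -/
theorem CharOpenSubgroup.exists_le {Δ : Subgroup P} (hΔ : IsTopologicallyFinitelyGenerated Δ)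
    (V : Subgroup P) (hVo : IsOpen ((V.subgroupOf Δ : Subgroup Δ) : Set Δ))
    [hVi : (V.subgroupOf Δ).FiniteIndex] : ∃ H : CharOpenSubgroup Δ, H.toSubgroup ≤ V := by
  obtain ⟨W, _, hWo, hWi, hWc, hWle⟩ := hΔ.exists_charOpen_normal_le (V.subgroupOf Δ) hVo
  have hW : (W.map Δ.subtype).subgroupOf Δ = W :=
    Subgroup.comap_map_eq_self_of_injective Δ.subtype_injective W
  refine ⟨⟨W.map Δ.subtype, Subgroup.map_subtype_le W, ?_, ?_, ?_⟩, ?_⟩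
  · rw [hW]
    exact hWo
  · rw [hW]
    exact hWi
  · intro α
    rw [hW]
    exact hWc α
  · calc W.map Δ.subtype ≤ (V.subgroupOf Δ).map Δ.subtype := Subgroup.map_mono hWle
      _ ≤ V := Subgroup.map_comap_le _ _


/-- **Cofinality of the index set, tempered form**: if `Δ ≤ Π` comes WITH a profinite completion
`ι : Δ → Δ̂` (`IsProfiniteCompletion`, [SemiAnbd] §6) whose `Δ̂` is topologically finitely generated
— the situation of [AbsTopI] Prop 4.10 p. 60 (`Δ^tp_X ⊆ Π^tp_X` with `Δ̂^tp_X ≅ π₁(X_k̄)`) — then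
every subgroup `V` whose trace on `Δ` is open of finite index contains an index of the
`(Q, Δ)`-co-free completion. [cite: MochizukiAbsTopI2012, §0 p.9] -/
theorem CharOpenSubgroup.exists_le_of_completion {Δ : Subgroup P} {Dhat : Type u}
    [Group Dhat] [TopologicalSpace Dhat] [IsTopologicalGroup Dhat] {ι : Δ →ₜ* Dhat}
    (hι : SemiGraphs.IsProfiniteCompletion ι) (hfg : IsTopologicallyFinitelyGenerated Dhat)
    (V : Subgroup P) (hVo : IsOpen ((V.subgroupOf Δ : Subgroup Δ) : Set Δ))
    [hVi : (V.subgroupOf Δ).FiniteIndex] : ∃ H : CharOpenSubgroup Δ, H.toSubgroup ≤ V := by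
  obtain ⟨W, hWo, hWi, hWc, hWle⟩ := hι.exists_charOpen_le hfg (V.subgroupOf Δ) hVo
  have hW : (W.map Δ.subtype).subgroupOf Δ = W :=
    Subgroup.comap_map_eq_self_of_injective Δ.subtype_injective W
  refine ⟨⟨W.map Δ.subtype, Subgroup.map_subtype_le W, ?_, ?_, ?_⟩, ?_⟩
  · rw [hW]
    exact hWo
  · rw [hW]
    exact hWi
  · intro α
    rw [hW]
    exact hWc α
  · calc W.map Δ.subtype ≤ (V.subgroupOf Δ).map Δ.subtype := Subgroup.map_mono hWle
      _ ≤ V := Subgroup.map_comap_le _ _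

end Literature.AnabelianGeometry.AbsoluteAnabelian.AbsTopI
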